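import Summits.PneNP.PneNP.Theses.PhaseTwins
import Summits.PneNP.PneNP.Theorems.PhaseTwinsMacroscopicTwinsAboveDefs
import Summits.PneNP.PneNP.Theorems.PhaseTwinsMacroscopicTwinsAboveMaxDegree
import Summits.PneNP.PneNP.Theorems.PhaseTwinsMacroscopicTwinsAboveDuplicator
import Summits.PneNP.PneNP.Theorems.PhaseTwinsMacroscopicTwinsAboveEnergy
import Summits.PneNP.PneNP.Theorems.PhaseTwinsMacroscopicTwinsAboveFarSystems
import Summits.PneNP.PneNP.Theorems.PhaseTwinsMacroscopicTwinsAboveParameters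
import Summits.PneNP.PneNP.Theorems.PhaseTwinsMacroscopicTwinsAboveConnector
import Summits.PneNP.PneNP.Theorems.PhaseTwinsPolyDepthTwinsAboveChargeVisible
import Summits.PneNP.PneNP.Theorems.PhaseTwinsPolyDepthTwinsAbove
import Literature.Computability.Complexity.HardcoreInapproximability
import Literature.ModelTheory.FiniteModelTheory.CkEquivHomCount
import Literature.ModelTheory.FiniteModelTheory.CkEquivTransfer

/-!
# Route PhaseTwins, item `MacroscopicTwinsAbove` (stmt-PneNP-2720): the composition of the line
# `literal-gadgets-cfi-apparatus` — the density-scale twins from Sly's gadget theorem (CONDITIONAL RESULT)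

`MacroscopicTwinsAbove`: for every `Δ ≥ 3` and real `λ > λ_c(Δ) = (Δ-1)^{Δ-1}/(Δ-2)^Δ` there is `δ > 0` such that for
EVERY `k` there are max-degree-`≤ Δ` graphs `G, H` on the same `n ≥ 1` vertices, homomorphism-indistinguishable over
all graphs of treewidth `< k`, with `e^{δ n} · Z_H(λ) ≤ Z_G(λ)` (`Z` the independence polynomial).

THE LINE (crux line `literal-gadgets-cfi-apparatus`, skeleton `Cruxes/MacroscopicTwinsAbove/Lines/…`, whose six
provable stubs are LANDED as the modules imported above). Fix `Δ ≥ 3`, `λ > λ_c(Δ)`. ONE Sly phase gadget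
`(G, W±, V±)` of ONE size `n = n(Δ, λ)` (hypothesis S1 = Sly 2010 Theorem 2.1 derandomised = the named fact
`Literature.Computability.Complexity.slyGadgetReduction`, via `slyGadgets_of_slyGadgetReduction`) gives `d ≤ Δ`,
`0 < q⁻ < q⁺ < 1`, `(GpropA)` at `n`, `(GpropB)` with `δ₁ = n^{-2θ} ≤ 1/2` and `slyM d θ n` ports per side. For every
`k`, `stub_farSystems` supplies a bounded-occurrence 3-XOR system that is a `(12(k+1), 1/2)`-boundary expander with a
right-hand side `b` that is `t`-far (`t ≥ η m`). The twins are the literal-gadget graphs `lgGraph E loc W 0` and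
`lgGraph E loc W b`: one gadget copy per literal, anti-aligned by `κ₁` pair edges, and `K` ten-vertex Cai–Fürer–Immerman
parity complexes per equation plugged into `V⁺` ports. `stub_duplicator` (CFI gauge + local consistency,
`ckEquiv_of_consistencyFamily`) gives `≡_{C^{k+1}}`; `stub_connector` (Sly's Lemma 2.2 for this wiring, copy-explicit
error `(1 ± δ₁)^{2nv}`) and `stub_energy` (charge visibility `Ψ1 < Ψ0` of the sibling line + the sector optimisation)
give the weight gap; `stub_parameters` fixes `n, K, κ₁`; `stub_maxDegree` bounds the degrees. The glue proved here
(`twins_of_estimates` = Sly's proof of Theorem 1 run for the two right-hand sides, `budget` = the per-variable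
arithmetic) yields `e^{δ N} Z(𝔊_b) ≤ Z(𝔊₀)` with `N = 2·nv·v + 10·m·K` and `δ = 1/(2v + 10cK + 1)` — a constant of
`(Δ, λ)` fixed BEFORE `k` — and the composition transports to `Fin N` and converts `≡_{C^{k+1}}` into the typed
hom-count clause by the Dvořák bridge `Dvorak2010.homCount_eq_of_ckEquiv`.

STATUS. The only hypothesis left is S1, the gadget theorem (Sly 2010 Thm 2.1 derandomised; in the tree it is
`slyGadgetReduction`, itself reduced to Sly's Theorem 3.10 by `slyGadgetReduction_of_thm310`), so this file proves
the item CONDITIONALLY: `MacroscopicTwinsAbove_of_slyGadgets` (hypothesis: the gadget theorem, verbatim the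
registered stub `stub_slyGadgets`) and `MacroscopicTwinsAbove_of_slyGadgetReduction : slyGadgetReduction →
MacroscopicTwinsAbove`. [folklore]
-/

noncomputable section

open scoped Classical BigOperators

namespace Summit.PneNP.PneNP.Cruxes.MacroscopicTwinsAbove.LiteralGadgetsCfiApparatus

open Finset
open Literature.Computability.Complexity (hardcoreZOn slyPhase SlyPropA SlyPropB slyB slyM
  slyGadgetReduction one_lt_slyB sum_hardcoreZOn_fiber hardcoreZOn_nonneg
  hardcoreZOn_le_independencePolynomial)
open Literature.ModelTheory.FiniteModelTheory (CkEquiv)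
open Literature.Probability.LatticeModels (independencePolynomial hardCoreThreshold hardCoreThreshold_pos
  independencePolynomial_pos)
open Literature.Combinatorics.SimpleGraph (treewidth)
open Summit.PneNP.PneNP.Theses.PhaseTwins (MacroscopicTwinsAbove)
open Summit.PneNP.PneNP.Cruxes.PolyDepthTwinsAbove.ParityWiredPorts (occP occM pairW cxWeight cxW pwPsi cxRho
  stub_chargeVisible slyGadgets_of_slyGadgetReduction independencePolynomial_map_equiv maxDegree_le_of_iso
  indepSum_eq)

-- `Summit.PneNP.PneNP.…` (summit = sub-problem name) trips the duplicate-namespace linter on every declaration.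
set_option linter.dupNamespace false

variable {nv m v P κ₁ D K : ℕ}

/-! ## Proved glue -/

/-- The weights `lgW` are nonnegative (`λ ≥ 0`, `q± ∈ [0, 1]`). [folklore] -/
theorem lgW_nonneg (E : Fin m → Fin 3 → Fin nv) {lam qp qm : ℝ} (hlam : 0 ≤ lam) (hqm0 : 0 ≤ qm)
    (hqm1 : qm ≤ 1) (hqp0 : 0 ≤ qp) (hqp1 : qp ≤ 1) (κ₁ K : ℕ) (b : Fin m → ZMod 2)
    (Y : Fin nv × ZMod 2 → Bool) : 0 ≤ lgW E lam qp qm κ₁ K b Y := by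
  have hocc : ∀ s, 0 ≤ occP qp qm s ∧ occP qp qm s ≤ 1 ∧ 0 ≤ occM qp qm s ∧ occM qp qm s ≤ 1 := by
    intro s; cases s <;> simp [occP, occM] <;> refine ⟨?_, ?_, ?_, ?_⟩ <;> assumption
  unfold lgW
  refine mul_nonneg (Finset.prod_nonneg fun x _ => ?_) (Finset.prod_nonneg fun e _ => pow_nonneg ?_ _)
  · unfold pairW
    refine pow_nonneg (mul_nonneg ?_ ?_) _
    · obtain ⟨h1, h2, -, -⟩ := hocc (Y (x, 0))
      obtain ⟨h3, h4, -, -⟩ := hocc (Y (x, 1))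
      nlinarith [mul_le_one₀ h2 h3 h4]
    · obtain ⟨-, -, h1, h2⟩ := hocc (Y (x, 0))
      obtain ⟨-, -, h3, h4⟩ := hocc (Y (x, 1))
      nlinarith [mul_le_one₀ h2 h3 h4]
  · unfold cxW cxWeight
    refine div_nonneg (Finset.sum_nonneg fun J _ => ?_) (pow_nonneg (by linarith) _)
    split_ifs
    · refine mul_nonneg (pow_nonneg hlam _) (Finset.prod_nonneg fun p _ => ?_)
      split_ifs
      · obtain ⟨-, h2, -, -⟩ := hocc (Y (E e p.1, p.2))
        linarith
      · exact zero_le_one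
    · exact le_rfl

/-- An occurrence labelling injective on the occurrences of each variable bounds the occurrence numbers by the
number `D` of labels. [folklore] -/
theorem occ_le_of_loc (E : Fin m → Fin 3 → Fin nv) (loc : Fin m × Fin 3 → Fin D)
    (hloc : ∀ p p' : Fin m × Fin 3, E p.1 p.2 = E p'.1 p'.2 → loc p = loc p' → p = p') (x : Fin nv) :
    (Finset.univ.filter fun p : Fin m × Fin 3 => E p.1 p.2 = x).card ≤ D := by
  have h := Finset.card_le_card_of_injOn loc
    (s := Finset.univ.filter fun p : Fin m × Fin 3 => E p.1 p.2 = x) (t := Finset.univ)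
    (fun p _ => Finset.mem_univ _) (fun p hp p' hp' hpp => by
      have hp1 : E p.1 p.2 = x := (Finset.mem_filter.1 (Finset.mem_coe.1 hp)).2
      have hp2 : E p'.1 p'.2 = x := (Finset.mem_filter.1 (Finset.mem_coe.1 hp')).2
      exact hloc p p' (hp1.trans hp2.symm) hpp)
  simpa using h

/-- **Sly's proof of Theorem 1 run for the two right-hand sides**: from the two `LGCutEstimate`s (error
`δ ≤ 1/2`), the weight gap `lgW b Y · T ≤ lgW 0 ref` for every phase vector `Y` and `R · (3n)^{2nv} ≤ T` one gets
`R · Z(𝔊_b) ≤ Z(𝔊₀)`. Upper bound: `Z(𝔊_b) = Σ_Y Z_{𝔊_b}(Y) ≤ (1+δ)^{2nv} (W₀/T) Σ_Y Z_base(Y) = (1+δ)^{2nv} (W₀/T)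
Z_base` (the sum over ALL phase vectors of the base weights is `Z_base`, so no entropy term appears); lower bound:
`Z(𝔊₀) ≥ Z_{𝔊₀}(ref) ≥ (1−δ)^{2nv} W₀ n^{−2nv} Z_base`; and `(1+δ) ≤ 3(1−δ)`. [cite: Sly2010, Theorem 1 (proof, §2.2)] -/
theorem twins_of_estimates (E : Fin m → Fin 3 → Fin nv) (loc : Fin m × Fin 3 → Fin D)
    (W : LWiring v P κ₁ D K) {lam qp qm δ : ℝ} (hlam : 0 ≤ lam) (hδ0 : 0 ≤ δ) (hδ : δ ≤ 1 / 2)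
    {n : ℕ} (hn : 0 < n) (b : Fin m → ZMod 2) (hWnn : ∀ Y, 0 ≤ lgW E lam qp qm κ₁ K b Y)
    (h0 : LGCutEstimate E loc W lam qp qm δ n 0) (hb : LGCutEstimate E loc W lam qp qm δ n b)
    {T R : ℝ} (hT : 0 < T) (hR : 0 ≤ R)
    (hgap : ∀ Y, lgW E lam qp qm κ₁ K b Y * T ≤ lgW E lam qp qm κ₁ K 0 lgRef)
    (hRT : R * (3 * (n : ℝ)) ^ (2 * nv) ≤ T) :
    R * independencePolynomial (lgGraph E loc W b) lam ≤ independencePolynomial (lgGraph E loc W 0) lam := by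
  set Zb : (Fin nv × ZMod 2 → Bool) → ℝ :=
    fun Y => hardcoreZOn (lgBase nv m W) lam (fun I => lgPhase W I = Y) with hZb
  set W0 : ℝ := lgW E lam qp qm κ₁ K 0 lgRef with hW0
  set Wb : (Fin nv × ZMod 2 → Bool) → ℝ := lgW E lam qp qm κ₁ K b with hWb
  set Zbase : ℝ := independencePolynomial (lgBase nv m W) lam with hZbase
  have hnR : (0 : ℝ) < n := by exact_mod_cast hn
  have hZb0 : ∀ Y, 0 ≤ Zb Y := fun Y => hardcoreZOn_nonneg _ hlam _
  have hZbase0 : 0 ≤ Zbase := (independencePolynomial_pos _ hlam).le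
  have hW00 : 0 ≤ W0 := by
    have h1 := hgap lgRef
    have h2 : 0 ≤ Wb lgRef * T := mul_nonneg (hWnn lgRef) hT.le
    exact h2.trans h1
  -- upper bound for `b`
  have hup : independencePolynomial (lgGraph E loc W b) lam ≤ (1 + δ) ^ (2 * nv) * (W0 / T) * Zbase := by
    rw [hZbase, ← sum_hardcoreZOn_fiber (lgGraph E loc W b) lam (lgPhase W),
      ← sum_hardcoreZOn_fiber (lgBase nv m W) lam (lgPhase W), Finset.mul_sum]
    refine Finset.sum_le_sum fun Y _ => ?_
    have h1 := (hb Y).2.2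
    have h2 : Wb Y ≤ W0 / T := by
      rw [le_div_iff₀ hT]; exact hgap Y
    have h1δ : 0 ≤ (1 + δ) ^ (2 * nv) := pow_nonneg (by linarith) _
    calc hardcoreZOn (lgGraph E loc W b) lam (fun I => lgPhase W I = Y)
        ≤ (1 + δ) ^ (2 * nv) * (Wb Y * Zb Y) := h1
      _ ≤ (1 + δ) ^ (2 * nv) * (W0 / T * Zb Y) :=
          mul_le_mul_of_nonneg_left (mul_le_mul_of_nonneg_right h2 (hZb0 Y)) h1δ
      _ = (1 + δ) ^ (2 * nv) * (W0 / T) * Zb Y := by ring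
  -- lower bound for `0`
  have hlo : (1 - δ) ^ (2 * nv) * W0 * (((n : ℝ) ^ (2 * nv))⁻¹ * Zbase) ≤
      independencePolynomial (lgGraph E loc W 0) lam := by
    have h1 := (h0 lgRef).2.1
    have h2 := (h0 lgRef).1
    have h1δ : 0 ≤ (1 - δ) ^ (2 * nv) := pow_nonneg (by linarith) _
    calc (1 - δ) ^ (2 * nv) * W0 * (((n : ℝ) ^ (2 * nv))⁻¹ * Zbase)
        ≤ (1 - δ) ^ (2 * nv) * W0 * Zb lgRef := mul_le_mul_of_nonneg_left h2 (mul_nonneg h1δ hW00)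
      _ = (1 - δ) ^ (2 * nv) * (W0 * Zb lgRef) := by ring
      _ ≤ hardcoreZOn (lgGraph E loc W 0) lam (fun I => lgPhase W I = lgRef) := h1
      _ ≤ independencePolynomial (lgGraph E loc W 0) lam := hardcoreZOn_le_independencePolynomial _ hlam _
  -- combine
  have hpow3 : (1 + δ) ^ (2 * nv) ≤ (3 * (1 - δ)) ^ (2 * nv) :=
    pow_le_pow_left₀ (by linarith) (by linarith) _
  have hWT : 0 ≤ W0 / T := div_nonneg hW00 hT.le
  have hn2 : (0 : ℝ) < (n : ℝ) ^ (2 * nv) := pow_pos hnR _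
  have hX : 0 ≤ (1 - δ) ^ (2 * nv) * W0 * (((n : ℝ) ^ (2 * nv))⁻¹ * Zbase) := by
    have h1δ : 0 ≤ (1 - δ) ^ (2 * nv) := pow_nonneg (by linarith) _
    positivity
  calc R * independencePolynomial (lgGraph E loc W b) lam
      ≤ R * ((1 + δ) ^ (2 * nv) * (W0 / T) * Zbase) := mul_le_mul_of_nonneg_left hup hR
    _ ≤ R * ((3 * (1 - δ)) ^ (2 * nv) * (W0 / T) * Zbase) := by
        refine mul_le_mul_of_nonneg_left ?_ hR
        exact mul_le_mul_of_nonneg_right (mul_le_mul_of_nonneg_right hpow3 hWT) hZbase0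
    _ = (R * (3 * (n : ℝ)) ^ (2 * nv) / T) *
          ((1 - δ) ^ (2 * nv) * W0 * (((n : ℝ) ^ (2 * nv))⁻¹ * Zbase)) := by
        rw [mul_pow, mul_pow]
        field_simp
    _ ≤ 1 * ((1 - δ) ^ (2 * nv) * W0 * (((n : ℝ) ^ (2 * nv))⁻¹ * Zbase)) := by
        refine mul_le_mul_of_nonneg_right ?_ hX
        rwa [div_le_one hT]
    _ = (1 - δ) ^ (2 * nv) * W0 * (((n : ℝ) ^ (2 * nv))⁻¹ * Zbase) := one_mul _
    _ ≤ independencePolynomial (lgGraph E loc W 0) lam := hlo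

/-- **The budget arithmetic**: the per-variable budget `1 + 2 log(3n) ≤ K η g` with `N = 2·nv·v + 10·m·K`,
`nv ≤ m ≤ c·nv`, `η m ≤ t` and `δ = 1/(2v + 10cK + 1)` gives `e^{δ N} (3n)^{2nv} ≤ e^{K t g}`. [folklore] -/
theorem budget {n K nv m t c v N : ℕ} {η g : ℝ} (hn : 0 < n) (hη : 0 ≤ η) (hg : 0 ≤ g)
    (hbudget : 1 + 2 * Real.log (3 * n) ≤ K * η * g) (hnvm : nv ≤ m) (hmc : m ≤ c * nv)
    (htη : η * m ≤ t) (hN : N = 2 * nv * v + 10 * m * K) :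
    Real.exp (1 / ((2 * v + 10 * c * K + 1 : ℕ) : ℝ) * N) * (3 * (n : ℝ)) ^ (2 * nv) ≤
      Real.exp (K * t * g) := by
  have hnR : (0 : ℝ) < n := by exact_mod_cast hn
  have h3n : (0 : ℝ) < 3 * n := by positivity
  have hQpos : (0 : ℝ) < ((2 * v + 10 * c * K + 1 : ℕ) : ℝ) := by positivity
  -- `δ N ≤ nv`
  have hN' : (N : ℝ) ≤ ((2 * v + 10 * c * K + 1 : ℕ) : ℝ) * nv := by
    have hmc' : (m : ℝ) ≤ c * nv := by exact_mod_cast hmc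
    have hK0 : (0 : ℝ) ≤ K := Nat.cast_nonneg K
    have hnv0 : (0 : ℝ) ≤ nv := Nat.cast_nonneg nv
    have hv0 : (0 : ℝ) ≤ v := Nat.cast_nonneg v
    have h1 : (10 : ℝ) * m * K ≤ 10 * (c * nv) * K := by nlinarith
    rw [hN]
    push_cast
    nlinarith
  have hδN : 1 / ((2 * v + 10 * c * K + 1 : ℕ) : ℝ) * N ≤ nv := by
    rw [one_div, inv_mul_le_iff₀ hQpos]
    exact hN'
  -- logarithmic form
  have hpow : (3 * (n : ℝ)) ^ (2 * nv) = Real.exp (2 * nv * Real.log (3 * n)) := by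
    rw [show (2 * nv * Real.log (3 * n) : ℝ) = ((2 * nv : ℕ) : ℝ) * Real.log (3 * n) by push_cast; ring,
      Real.exp_nat_mul, Real.exp_log h3n]
  rw [hpow, ← Real.exp_add, Real.exp_le_exp]
  have hKg : (0 : ℝ) ≤ K * g := mul_nonneg (Nat.cast_nonneg K) hg
  have hnvm' : (nv : ℝ) ≤ m := by exact_mod_cast hnvm
  calc 1 / ((2 * v + 10 * c * K + 1 : ℕ) : ℝ) * N + 2 * nv * Real.log (3 * n)
      ≤ nv * (1 + 2 * Real.log (3 * n)) := by linarith
    _ ≤ nv * (K * η * g) := mul_le_mul_of_nonneg_left hbudget (Nat.cast_nonneg nv)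
    _ = K * g * (η * nv) := by ring
    _ ≤ K * g * (η * m) := mul_le_mul_of_nonneg_left (mul_le_mul_of_nonneg_left hnvm' hη) hKg
    _ ≤ K * g * t := mul_le_mul_of_nonneg_left htη hKg
    _ = K * t * g := by ring

/-! ## The composition -/

/-- **`MacroscopicTwinsAbove` from the gadget theorem** (Sly 2010 Thm 2.1 derandomised — the registered stub
`stub_slyGadgets`, verbatim; every other stub of the line is a landed theorem). Given `Δ ≥ 3` and `λ > λ_c(Δ)`: S1
gives `d, θ, q±` and a gadget threshold; charge visibility gives `g = Ψ0 − Ψ1 > 0`; `stub_farSystems` gives the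
constants `D, c, η`; `stub_parameters` fixes ONE gadget size `n` with `K, κ₁` meeting the port budget, the sector
inequality, `n^{−2θ} ≤ 1/2` and the per-variable budget; the gadget at `n` and `δ := 1/(2v + 10cK + 1)` are fixed
BEFORE `k`. For each `k`: the far, `(12(k+1), 1/2)`-expanding system `(E, loc, b, t)`; the twins `lgGraph E loc W 0`,
`lgGraph E loc W b` transported to `Fin N`, `N = 2·nv·v + 10·m·K`: degrees by `stub_maxDegree`; `≡_{C^{k+1}}` by
`stub_duplicator` (`p = 2`, `q = 1`, `s = 12(k+1)`, `K₀ = 3(k+1)`) and `CkEquiv.iso_congr`, turned into the hom-count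
clause for treewidth `< k` by the Dvořák bridge; the gap `e^{δN}` by `stub_connector` (twice), `stub_energy`, `budget`
and `twins_of_estimates`. [folklore] -/
theorem MacroscopicTwinsAbove_of_slyGadgets
    (hS1 : ∀ Δ : ℕ, 3 ≤ Δ → ∀ lam : ℝ, hardCoreThreshold Δ < lam →
      ∃ d : ℕ, 3 ≤ d ∧ d ≤ Δ ∧ hardCoreThreshold d < lam ∧
      ∃ θ qp qm : ℝ, 0 < θ ∧ θ < 1 / 8 ∧ 0 < qm ∧ qm < qp ∧ qp < 1 ∧
        ∃ n₁ : ℕ, ∀ n : ℕ, n₁ ≤ n →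
          ∃ (v : ℕ) (G : SimpleGraph (Fin v)) (Wp Wm : Finset (Fin v))
            (Vp Vm : Fin (slyM d θ n) ↪ Fin v),
            (v : ℝ) ≤ 3 * n ∧ G.maxDegree ≤ d ∧ Disjoint Wp Wm ∧
              Disjoint (Set.range Vp) (Set.range Vm) ∧
              (∀ i, G.degree (Vp i) ≤ d - 1) ∧ (∀ i, G.degree (Vm i) ≤ d - 1) ∧
              SlyPropA G lam Wp Wm n ∧
              SlyPropB G lam Wp Wm Vp Vm qp qm ((n : ℝ) ^ (-(2 * θ)))) :
    MacroscopicTwinsAbove := by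
  intro Δ hΔ lam hlam
  have hlam' : hardCoreThreshold Δ < lam := hlam
  obtain ⟨d, hd3, hdΔ, hdlam, θ, qp, qm, hθ, -, hqm, hlt, hqp, nA, hnA⟩ := hS1 Δ hΔ lam hlam'
  have hlam0 : 0 < lam := (hardCoreThreshold_pos hd3).trans hdlam
  -- the energy landscape: contrast `g > 0` and the sector optimisation
  have hvis : pwPsi lam qp qm 1 < pwPsi lam qp qm 0 := stub_chargeVisible hlam0 hqm hlt hqp
  have hg : 0 < pwPsi lam qp qm 0 - pwPsi lam qp qm 1 := sub_pos.2 hvis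
  have hLB : 0 < Real.log (slyB qp qm) := Real.log_pos (one_lt_slyB hqm hlt hqp)
  -- the constants of the base systems
  obtain ⟨D, c, η, hη, hsys⟩ := stub_farSystems
  -- ONE gadget size `n` and the numbers `K, κ₁`
  obtain ⟨n, K, κ₁, hnA', hn, hK1, hslots, hcouple, hδhalf, hbud⟩ :=
    stub_parameters hθ hd3 D hη hg hLB (Real.log (cxRho lam qp qm)) nA
  obtain ⟨v, G, Wp, Wm, Vp, Vm, -, hdeg, -, hVV, hdp, hdm, hA, hB⟩ := hnA n hnA'
  let W : LWiring v (slyM d θ n) κ₁ D K := ⟨G, Wp, Wm, Vp, Vm, slotEmb hslots⟩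
  have hnR : (0 : ℝ) < n := by exact_mod_cast hn
  have hδ0 : 0 ≤ (n : ℝ) ^ (-(2 * θ)) := Real.rpow_nonneg hnR.le _
  -- the density constant, fixed before `k`
  refine ⟨1 / ((2 * v + 10 * c * K + 1 : ℕ) : ℝ), by positivity, fun k => ?_⟩
  -- the base system at radius `12 (k + 1)`
  obtain ⟨nv, m, t, E, loc, b, hnv, hnvm, hmc, hE, hloc, hexp, htη, hfar⟩ := hsys (12 * (k + 1))
  let X : SimpleGraph (LGVert nv m v K) := lgGraph E loc W 0
  let X' : SimpleGraph (LGVert nv m v K) := lgGraph E loc W b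
  let N : ℕ := Fintype.card (LGVert nv m v K)
  have hNcard : N = 2 * nv * v + 10 * m * K := card_LGVert nv m v K
  let e : LGVert nv m v K ≃ Fin N := Fintype.equivFin (LGVert nv m v K)
  -- the estimates
  have hcut0 : LGCutEstimate E loc W lam qp qm ((n : ℝ) ^ (-(2 * θ))) n 0 :=
    stub_connector E loc hloc W hlam0.le hqm hlt hqp hδ0 (hδhalf.trans (by norm_num)) hn hVV hA hB 0
  have hcutb : LGCutEstimate E loc W lam qp qm ((n : ℝ) ^ (-(2 * θ))) n b :=
    stub_connector E loc hloc W hlam0.le hqm hlt hqp hδ0 (hδhalf.trans (by norm_num)) hn hVV hA hB b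
  have hgap : ∀ Y : Fin nv × ZMod 2 → Bool,
      lgW E lam qp qm κ₁ K b Y * Real.exp (K * t * (pwPsi lam qp qm 0 - pwPsi lam qp qm 1)) ≤
        lgW E lam qp qm κ₁ K 0 lgRef :=
    fun Y => stub_energy hlam0 hqm hlt hqp E (occ_le_of_loc E loc hloc) b t hfar hcouple Y
  have hRT := budget (v := v) (N := N) hn hη.le hg.le hbud hnvm hmc htη hNcard
  have htwins : Real.exp (1 / ((2 * v + 10 * c * K + 1 : ℕ) : ℝ) * N) * independencePolynomial X' lam ≤
      independencePolynomial X lam :=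
    twins_of_estimates E loc W hlam0.le hδ0 hδhalf hn b
      (fun Y => lgW_nonneg E hlam0.le hqm.le (hlt.le.trans hqp.le) (hqm.le.trans hlt.le) hqp.le κ₁ K b Y)
      hcut0 hcutb (Real.exp_pos _) (Real.exp_pos _).le hgap hRT
  -- Duplicator at depth `k + 1`
  have hck : CkEquiv (k + 1) X X' :=
    stub_duplicator E hE loc W b (s := 12 * (k + 1)) (p := 2) (q := 1) (K₀ := 3 * (k + 1)) (by omega)
      one_pos (fun T hT => by rw [one_mul]; exact hexp T hT) (by omega) le_rfl
  have hdegX : X.maxDegree ≤ Δ := stub_maxDegree E loc hloc W 0 hΔ hdΔ hdeg hVV hdp hdm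
  have hdegX' : X'.maxDegree ≤ Δ := stub_maxDegree E loc hloc W b hΔ hdΔ hdeg hVV hdp hdm
  refine ⟨N, X.map e.toEmbedding, X'.map e.toEmbedding, ?_, ?_, ?_, ?_, ?_⟩
  · -- `0 < N`
    rw [hNcard]
    have h1 : 1 ≤ m := hnv.trans_le hnvm
    have h2 : 10 * 1 * 1 ≤ 10 * m * K := Nat.mul_le_mul (Nat.mul_le_mul_left 10 h1) hK1
    omega
  · -- maximum degree of the first twin
    exact maxDegree_le_of_iso (SimpleGraph.Iso.map e X) hdegX
  · -- maximum degree of the second twin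
    exact maxDegree_le_of_iso (SimpleGraph.Iso.map e X') hdegX'
  · -- homomorphism indistinguishability below treewidth `k < k + 1`
    intro mF F hF
    have hck' : CkEquiv (k + 1) (X.map e.toEmbedding) (X'.map e.toEmbedding) :=
      hck.iso_congr (SimpleGraph.Iso.map e X) (SimpleGraph.Iso.map e X')
    exact Literature.ModelTheory.FiniteModelTheory.Dvorak2010.homCount_eq_of_ckEquiv (by omega) hck' F
      (Nat.lt_succ_of_lt hF)
  · -- the macroscopic gap, transported to `Fin N`
    have hZ := htwins
    rw [← independencePolynomial_map_equiv X e lam, ← independencePolynomial_map_equiv X' e lam] at hZ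
    convert hZ using 2 <;> exact indepSum_eq _ _

/-- **The item from the named fact** (CONDITIONAL RESULT): Sly's gadget reduction `slyGadgetReduction`
(Sly 2010 Thm 2.1 + Lemma 2.2, derandomised; GŠV16 Lemma 19) implies `MacroscopicTwinsAbove` — for every `Δ ≥ 3`
and `λ > λ_c(Δ)` the density `(1/n) log Z_G(λ)` is not determined by the `C^k`-type of a max-degree-`Δ` graph for
any fixed `k`. [folklore] -/
theorem MacroscopicTwinsAbove_of_slyGadgetReduction (h : slyGadgetReduction) : MacroscopicTwinsAbove :=
  MacroscopicTwinsAbove_of_slyGadgets (slyGadgets_of_slyGadgetReduction h)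

end Summit.PneNP.PneNP.Cruxes.MacroscopicTwinsAbove.LiteralGadgetsCfiApparatus
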